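import Mathlib

/-!
# Quadratic parts modulo squares in characteristic `2`: polar rank `≤ 2` (chain W4.1, crux `Steer`)

OURS (campaign res-hironaka, rung L, slot W4.1; helper for crux `Steer` stmt-ResolutionOfSingularities-16345,
σ-residual LOW half, the char-`2` local-algebra core of res-L0-w41-strat-2's one-step lemma B7
`rankFour_exit_two` (STRAT2-MEMO-1 §4b; `L/res-L0-w41-strat-2/R2TwoSigma-s16-strat2.delta.lean`)). Pure commutative
algebra; NOT a statement of any manuscript; nothing here is attributed to [claim: Hironaka2017,
status: under-review]. AI-written; weaker than expert review.

Setting: `R` a local ring of characteristic `2` whose residue field is perfect in the weak form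
`∀ a, ∃ b, a - b ^ 2 ∈ 𝔪` («every residue is a square»), elements `w₀, …, w₃ ∈ 𝔪`. A quadratic expression
`Σ a_{jk} w_j w_k` is read modulo `𝔪 ^ 3` and modulo SQUARES; what survives is the alternating («polar»)
matrix `b_{jk} = a_{jk} + a_{kj}` (`j < k`) over the residue field. Results:

* `exists_sq_sub_diag_mem` — diagonal forms `Σ d_j w_j ^ 2` are squares modulo `𝔪 ^ 3`;
* `offDiag_three`, `quadratic_three` — in THREE variables every quadratic expression is
  `ℓ ^ 2 + z * v` modulo `𝔪 ^ 3` with `z, v ∈ 𝔪` (a `3 × 3` alternating matrix is decomposable);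
* `offDiag_four`, `quadratic_four` — in FOUR variables the same holds as soon as the PFAFFIAN
  `b₀₁ b₂₃ + b₀₂ b₁₃ + b₀₃ b₁₂` lies in `𝔪` (explicitly: if `b₀₁` is a unit, `λ := Σ_k b₀ₖ w_k`,
  `μ := Σ_k b₁ₖ w_k` satisfy `λ μ = b₀₁ · (off-diagonal part) + Pf · w₂ w₃ + (diagonal)`);
* `pfaffian_mul_eq_zero_of_kernel`, `pfaffian_eq_zero_of_kernel` — a `4 × 4` alternating matrix over a
  ring of characteristic `2` with a kernel vector `c` has `Pf · c_j = 0`; over a field, `c ≠ 0 ⇒ Pf = 0`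
  (`A · A* = Pf · 1`). Used with the residue field of the NEXT member of the run, where the kernel vector
  lives (the point blown up need not be rational): the Pfaffian, having entries downstairs, vanishes there too.

References: W. Scharlau, *Quadratic and Hermitian Forms*, Ch. 1 §4 and Ch. 9 (quadratic forms in
characteristic 2, polar form) — only the elementary identities are used. [folklore]
-/

noncomputable section

-- `Summit.<S>.<S>.…` duplicates the summit name by design (single-problem summit).
set_option linter.dupNamespace false

namespace Summit.ResolutionOfSingularities.ResolutionOfSingularities.Theorems.SwitchingDichotomy.PolarRank

open IsLocalRing

universe u

/-! ## §1 The Pfaffian of a `4 × 4` alternating matrix and its kernel -/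

section Pfaffian

variable {S : Type u} [CommRing S]

/-- **`A* · (A c) = Pf(A) · c` in characteristic `2`, first coordinate**: for an alternating `4 × 4` matrix
`(b_{jk})` (zero diagonal, `b_{kj} = b_{jk}`) and any vector `c`,
`b₂₃ (A c)₁ + b₁₃ (A c)₂ + b₁₂ (A c)₃ = Pf · c₀`. So a kernel vector is killed by the Pfaffian. [folklore] -/
theorem pfaffian_mul_eq_zero_of_kernel [CharP S 2] (b₀₁ b₀₂ b₀₃ b₁₂ b₁₃ b₂₃ c₀ c₁ c₂ c₃ : S)
    (h₁ : b₀₁ * c₀ + b₁₂ * c₂ + b₁₃ * c₃ = 0) (h₂ : b₀₂ * c₀ + b₁₂ * c₁ + b₂₃ * c₃ = 0)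
    (h₃ : b₀₃ * c₀ + b₁₃ * c₁ + b₂₃ * c₂ = 0) :
    (b₀₁ * b₂₃ + b₀₂ * b₁₃ + b₀₃ * b₁₂) * c₀ = 0 := by
  have h2 : (2 : S) = 0 := by
    have := CharP.cast_eq_zero S 2
    simpa using this
  linear_combination b₂₃ * h₁ + b₁₃ * h₂ + b₁₂ * h₃ -
    (b₁₂ * b₁₃ * c₁ + b₁₂ * b₂₃ * c₂ + b₁₃ * b₂₃ * c₃) * h2

/-- **A `4 × 4` alternating matrix with a non-zero kernel vector over a field of characteristic `2` has
Pfaffian `0`** (all four coordinates: apply `pfaffian_mul_eq_zero_of_kernel` to the relabelled matrix).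
[folklore] -/
theorem pfaffian_eq_zero_of_kernel {F : Type u} [Field F] [CharP F 2]
    (b₀₁ b₀₂ b₀₃ b₁₂ b₁₃ b₂₃ : F) (c : Fin 4 → F) (hc : c ≠ 0)
    (h₀ : b₀₁ * c 1 + b₀₂ * c 2 + b₀₃ * c 3 = 0) (h₁ : b₀₁ * c 0 + b₁₂ * c 2 + b₁₃ * c 3 = 0)
    (h₂ : b₀₂ * c 0 + b₁₂ * c 1 + b₂₃ * c 3 = 0) (h₃ : b₀₃ * c 0 + b₁₃ * c 1 + b₂₃ * c 2 = 0) :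
    b₀₁ * b₂₃ + b₀₂ * b₁₃ + b₀₃ * b₁₂ = 0 := by
  by_contra hpf
  apply hc
  -- every coordinate is killed by the (non-zero) Pfaffian
  have k₀ := pfaffian_mul_eq_zero_of_kernel b₀₁ b₀₂ b₀₃ b₁₂ b₁₃ b₂₃ (c 0) (c 1) (c 2) (c 3) h₁ h₂ h₃
  have k₁ := pfaffian_mul_eq_zero_of_kernel b₀₁ b₁₂ b₁₃ b₀₂ b₀₃ b₂₃ (c 1) (c 0) (c 2) (c 3)
    (by linear_combination h₀) (by linear_combination h₂) (by linear_combination h₃)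
  have k₂ := pfaffian_mul_eq_zero_of_kernel b₀₂ b₁₂ b₂₃ b₀₁ b₀₃ b₁₃ (c 2) (c 0) (c 1) (c 3)
    (by linear_combination h₀) (by linear_combination h₁) (by linear_combination h₃)
  have k₃ := pfaffian_mul_eq_zero_of_kernel b₀₃ b₁₃ b₂₃ b₀₁ b₀₂ b₁₂ (c 3) (c 0) (c 1) (c 2)
    (by linear_combination h₀) (by linear_combination h₁) (by linear_combination h₂)
  have e₁ : (b₀₁ * b₂₃ + b₁₂ * b₀₃ + b₁₃ * b₀₂) = b₀₁ * b₂₃ + b₀₂ * b₁₃ + b₀₃ * b₁₂ := by ring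
  have e₂ : (b₀₂ * b₁₃ + b₁₂ * b₀₃ + b₂₃ * b₀₁) = b₀₁ * b₂₃ + b₀₂ * b₁₃ + b₀₃ * b₁₂ := by ring
  have e₃ : (b₀₃ * b₁₂ + b₁₃ * b₀₂ + b₂₃ * b₀₁) = b₀₁ * b₂₃ + b₀₂ * b₁₃ + b₀₃ * b₁₂ := by ring
  rw [e₁] at k₁
  rw [e₂] at k₂
  rw [e₃] at k₃
  funext j
  fin_cases j
  · exact (mul_eq_zero.mp k₀).resolve_left hpf
  · exact (mul_eq_zero.mp k₁).resolve_left hpf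
  · exact (mul_eq_zero.mp k₂).resolve_left hpf
  · exact (mul_eq_zero.mp k₃).resolve_left hpf

end Pfaffian

/-! ## §2 Quadratic expressions modulo `𝔪 ^ 3` and squares over a local ring of characteristic `2` -/

section Local

variable {R : Type u} [CommRing R] [IsLocalRing R] [CharP R 2]

omit [CharP R 2] in
/-- Products of three elements of `𝔪` lie in `𝔪 ^ 3`. [folklore] -/
theorem mul_mul_mem_pow_three {x y z : R} (hx : x ∈ maximalIdeal R) (hy : y ∈ maximalIdeal R)
    (hz : z ∈ maximalIdeal R) : x * y * z ∈ maximalIdeal R ^ 3 := by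
  rw [pow_succ, pow_two]
  exact Ideal.mul_mem_mul (Ideal.mul_mem_mul hx hy) hz

omit [IsLocalRing R] in
/-- In characteristic `2`, `(a + b) ^ 2 = a ^ 2 + b ^ 2`. [folklore] -/
theorem add_sq_char_two (a b : R) : (a + b) ^ 2 = a ^ 2 + b ^ 2 := by
  have h2 : (2 : R) = 0 := by
    have := CharP.cast_eq_zero R 2
    simpa using this
  linear_combination (a * b) * h2

omit [CharP R 2] in
/-- **Diagonal forms are squares modulo `𝔪 ^ 3`**: if every residue is a square, then for `w ∈ 𝔪`,
`d w ^ 2 ≡ (e w) ^ 2` with `d - e ^ 2 ∈ 𝔪`; summing (characteristic `2`: the square of a sum is the sum of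
the squares) handles any diagonal form. One variable: [folklore] -/
theorem exists_sq_sub_diag_mem_one (hperf : ∀ a : R, ∃ b : R, a - b ^ 2 ∈ maximalIdeal R) (d w : R)
    (hw : w ∈ maximalIdeal R) : ∃ e : R, d * w ^ 2 - (e * w) ^ 2 ∈ maximalIdeal R ^ 3 := by
  obtain ⟨e, he⟩ := hperf d
  refine ⟨e, ?_⟩
  have : d * w ^ 2 - (e * w) ^ 2 = (d - e ^ 2) * w * w := by ring
  rw [this]
  exact mul_mul_mem_pow_three he hw hw

/-- Diagonal forms in four variables are squares modulo `𝔪 ^ 3`. [folklore] -/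
theorem exists_sq_sub_diag_mem (hperf : ∀ a : R, ∃ b : R, a - b ^ 2 ∈ maximalIdeal R)
    (d₀ d₁ d₂ d₃ w₀ w₁ w₂ w₃ : R) (h₀ : w₀ ∈ maximalIdeal R) (h₁ : w₁ ∈ maximalIdeal R)
    (h₂ : w₂ ∈ maximalIdeal R) (h₃ : w₃ ∈ maximalIdeal R) :
    ∃ ℓ : R, d₀ * w₀ ^ 2 + d₁ * w₁ ^ 2 + d₂ * w₂ ^ 2 + d₃ * w₃ ^ 2 - ℓ ^ 2 ∈ maximalIdeal R ^ 3 := by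
  obtain ⟨e₀, k₀⟩ := exists_sq_sub_diag_mem_one hperf d₀ w₀ h₀
  obtain ⟨e₁, k₁⟩ := exists_sq_sub_diag_mem_one hperf d₁ w₁ h₁
  obtain ⟨e₂, k₂⟩ := exists_sq_sub_diag_mem_one hperf d₂ w₂ h₂
  obtain ⟨e₃, k₃⟩ := exists_sq_sub_diag_mem_one hperf d₃ w₃ h₃
  refine ⟨e₀ * w₀ + e₁ * w₁ + e₂ * w₂ + e₃ * w₃, ?_⟩
  have hsq : (e₀ * w₀ + e₁ * w₁ + e₂ * w₂ + e₃ * w₃) ^ 2 =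
      (e₀ * w₀) ^ 2 + (e₁ * w₁) ^ 2 + (e₂ * w₂) ^ 2 + (e₃ * w₃) ^ 2 := by
    rw [add_sq_char_two, add_sq_char_two, add_sq_char_two]
  have : d₀ * w₀ ^ 2 + d₁ * w₁ ^ 2 + d₂ * w₂ ^ 2 + d₃ * w₃ ^ 2 -
      (e₀ * w₀ + e₁ * w₁ + e₂ * w₂ + e₃ * w₃) ^ 2 =
      (d₀ * w₀ ^ 2 - (e₀ * w₀) ^ 2) + (d₁ * w₁ ^ 2 - (e₁ * w₁) ^ 2) +
        (d₂ * w₂ ^ 2 - (e₂ * w₂) ^ 2) + (d₃ * w₃ ^ 2 - (e₃ * w₃) ^ 2) := by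
    rw [hsq]; ring
  rw [this]
  exact add_mem (add_mem (add_mem k₀ k₁) k₂) k₃

omit [CharP R 2] in
/-- **Three variables, pivot case**: if `b₀₁` is a unit then
`b₀₁ w₀w₁ + b₀₂ w₀w₂ + b₁₂ w₁w₂ ≡ z v + ℓ ^ 2 (mod 𝔪 ^ 3)` with
`z = b₀₁⁻¹ (b₀₁ w₁ + b₀₂ w₂)`, `v = b₀₁ w₀ + b₁₂ w₂` (the leftover `b₀₁⁻¹ b₀₂ b₁₂ w₂ ^ 2` is a square modulo
`𝔪 ^ 3`). [folklore] -/
theorem offDiag_three_of_isUnit (hperf : ∀ a : R, ∃ b : R, a - b ^ 2 ∈ maximalIdeal R)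
    (b₀₁ b₀₂ b₁₂ w₀ w₁ w₂ : R) (hu : IsUnit b₀₁) (h₀ : w₀ ∈ maximalIdeal R) (h₁ : w₁ ∈ maximalIdeal R)
    (h₂ : w₂ ∈ maximalIdeal R) :
    ∃ ℓ z v : R, z ∈ maximalIdeal R ∧ v ∈ maximalIdeal R ∧
      b₀₁ * w₀ * w₁ + b₀₂ * w₀ * w₂ + b₁₂ * w₁ * w₂ - ℓ ^ 2 - z * v ∈ maximalIdeal R ^ 3 := by
  obtain ⟨i, hi⟩ := hu.exists_left_inv
  obtain ⟨e, he⟩ := exists_sq_sub_diag_mem_one hperf (-(i * b₀₂ * b₁₂)) w₂ h₂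
  refine ⟨e * w₂, i * (b₀₁ * w₁ + b₀₂ * w₂), b₀₁ * w₀ + b₁₂ * w₂, ?_, ?_, ?_⟩
  · exact Ideal.mul_mem_left _ _ (add_mem (Ideal.mul_mem_left _ _ h₁) (Ideal.mul_mem_left _ _ h₂))
  · exact add_mem (Ideal.mul_mem_left _ _ h₀) (Ideal.mul_mem_left _ _ h₂)
  · have : b₀₁ * w₀ * w₁ + b₀₂ * w₀ * w₂ + b₁₂ * w₁ * w₂ - (e * w₂) ^ 2 -
        i * (b₀₁ * w₁ + b₀₂ * w₂) * (b₀₁ * w₀ + b₁₂ * w₂) =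
        -(i * b₀₂ * b₁₂) * w₂ ^ 2 - (e * w₂) ^ 2 := by
      linear_combination (-(b₀₁ * w₀ * w₁ + b₀₂ * w₀ * w₂ + b₁₂ * w₁ * w₂)) * hi
    rw [this]
    exact he

omit [CharP R 2] in
/-- **Three variables**: every off-diagonal quadratic expression in `w₀, w₁, w₂ ∈ 𝔪` is `ℓ ^ 2 + z v` modulo
`𝔪 ^ 3` with `z, v ∈ 𝔪` (a `3 × 3` alternating matrix has rank `≤ 2`: pivot on a unit entry, or all entries
lie in `𝔪`). [folklore] -/
theorem offDiag_three (hperf : ∀ a : R, ∃ b : R, a - b ^ 2 ∈ maximalIdeal R)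
    (b₀₁ b₀₂ b₁₂ w₀ w₁ w₂ : R) (h₀ : w₀ ∈ maximalIdeal R) (h₁ : w₁ ∈ maximalIdeal R)
    (h₂ : w₂ ∈ maximalIdeal R) :
    ∃ ℓ z v : R, z ∈ maximalIdeal R ∧ v ∈ maximalIdeal R ∧
      b₀₁ * w₀ * w₁ + b₀₂ * w₀ * w₂ + b₁₂ * w₁ * w₂ - ℓ ^ 2 - z * v ∈ maximalIdeal R ^ 3 := by
  by_cases u₀₁ : IsUnit b₀₁
  · exact offDiag_three_of_isUnit hperf b₀₁ b₀₂ b₁₂ w₀ w₁ w₂ u₀₁ h₀ h₁ h₂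
  by_cases u₀₂ : IsUnit b₀₂
  · obtain ⟨ℓ, z, v, hz, hv, h⟩ := offDiag_three_of_isUnit hperf b₀₂ b₀₁ b₁₂ w₀ w₂ w₁ u₀₂ h₀ h₂ h₁
    refine ⟨ℓ, z, v, hz, hv, ?_⟩
    have e : b₀₁ * w₀ * w₁ + b₀₂ * w₀ * w₂ + b₁₂ * w₁ * w₂ =
        b₀₂ * w₀ * w₂ + b₀₁ * w₀ * w₁ + b₁₂ * w₂ * w₁ := by ring
    rwa [e]
  by_cases u₁₂ : IsUnit b₁₂
  · obtain ⟨ℓ, z, v, hz, hv, h⟩ := offDiag_three_of_isUnit hperf b₁₂ b₀₁ b₀₂ w₁ w₂ w₀ u₁₂ h₁ h₂ h₀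
    refine ⟨ℓ, z, v, hz, hv, ?_⟩
    have e : b₀₁ * w₀ * w₁ + b₀₂ * w₀ * w₂ + b₁₂ * w₁ * w₂ =
        b₁₂ * w₁ * w₂ + b₀₁ * w₁ * w₀ + b₀₂ * w₂ * w₀ := by ring
    rwa [e]
  -- all three coefficients lie in `𝔪`
  rw [← mem_nonunits_iff, ← IsLocalRing.mem_maximalIdeal] at u₀₁ u₀₂ u₁₂
  refine ⟨0, 0, 0, zero_mem _, zero_mem _, ?_⟩
  have e : b₀₁ * w₀ * w₁ + b₀₂ * w₀ * w₂ + b₁₂ * w₁ * w₂ - 0 ^ 2 - 0 * 0 =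
      b₀₁ * w₀ * w₁ + b₀₂ * w₀ * w₂ + b₁₂ * w₁ * w₂ := by ring
  rw [e]
  exact add_mem (add_mem (mul_mul_mem_pow_three u₀₁ h₀ h₁) (mul_mul_mem_pow_three u₀₂ h₀ h₂))
    (mul_mul_mem_pow_three u₁₂ h₁ h₂)

/-- **Polar rank `≤ 2` in three variables**: EVERY quadratic expression `Σ_{j,k<3} a_{jk} w_j w_k` with
`w_j ∈ 𝔪` is `ℓ ^ 2 + z v` modulo `𝔪 ^ 3`, `z, v ∈ 𝔪`. [folklore] -/
theorem quadratic_three (hperf : ∀ a : R, ∃ b : R, a - b ^ 2 ∈ maximalIdeal R)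
    (a : Fin 3 → Fin 3 → R) (w : Fin 3 → R) (hw : ∀ j, w j ∈ maximalIdeal R) :
    ∃ ℓ z v : R, z ∈ maximalIdeal R ∧ v ∈ maximalIdeal R ∧
      (∑ j, ∑ k, a j k * w j * w k) - ℓ ^ 2 - z * v ∈ maximalIdeal R ^ 3 := by
  obtain ⟨ℓ₁, z, v, hz, hv, hoff⟩ := offDiag_three hperf (a 0 1 + a 1 0) (a 0 2 + a 2 0) (a 1 2 + a 2 1)
    (w 0) (w 1) (w 2) (hw 0) (hw 1) (hw 2)
  obtain ⟨ℓ₂, hdiag⟩ := exists_sq_sub_diag_mem hperf (a 0 0) (a 1 1) (a 2 2) 0 (w 0) (w 1) (w 2) 0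
    (hw 0) (hw 1) (hw 2) (zero_mem _)
  refine ⟨ℓ₁ + ℓ₂, z, v, hz, hv, ?_⟩
  have e : (∑ j, ∑ k, a j k * w j * w k) - (ℓ₁ + ℓ₂) ^ 2 - z * v =
      ((a 0 1 + a 1 0) * w 0 * w 1 + (a 0 2 + a 2 0) * w 0 * w 2 + (a 1 2 + a 2 1) * w 1 * w 2
          - ℓ₁ ^ 2 - z * v) +
        (a 0 0 * w 0 ^ 2 + a 1 1 * w 1 ^ 2 + a 2 2 * w 2 ^ 2 + 0 * (0 : R) ^ 2 - ℓ₂ ^ 2) := by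
    simp only [Fin.sum_univ_three, add_sq_char_two ℓ₁ ℓ₂]
    ring
  rw [e]
  exact add_mem hoff hdiag

/-- **Four variables, pivot case**: if `b₀₁` is a unit and the PFAFFIAN lies in `𝔪`, then the off-diagonal
expression is `ℓ ^ 2 + z v` modulo `𝔪 ^ 3` with `z = b₀₁⁻¹ (b₀₁ w₁ + b₀₂ w₂ + b₀₃ w₃)`,
`v = b₀₁ w₀ + b₁₂ w₂ + b₁₃ w₃`: indeed `(Σ_k b₀ₖ w_k)(Σ_k b₁ₖ w_k) = b₀₁ · (off-diagonal) + Pf · w₂ w₃ +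
b₀₂ b₁₂ w₂² + b₀₃ b₁₃ w₃²` in characteristic `2` (the `w₂ w₃` coefficient is
`b₀₂ b₁₃ + b₀₃ b₁₂ = Pf + b₀₁ b₂₃`). [folklore] -/
theorem offDiag_four_of_isUnit (hperf : ∀ a : R, ∃ b : R, a - b ^ 2 ∈ maximalIdeal R)
    (b₀₁ b₀₂ b₀₃ b₁₂ b₁₃ b₂₃ w₀ w₁ w₂ w₃ : R) (hu : IsUnit b₀₁)
    (hpf : b₀₁ * b₂₃ + b₀₂ * b₁₃ + b₀₃ * b₁₂ ∈ maximalIdeal R)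
    (h₀ : w₀ ∈ maximalIdeal R) (h₁ : w₁ ∈ maximalIdeal R) (h₂ : w₂ ∈ maximalIdeal R)
    (h₃ : w₃ ∈ maximalIdeal R) :
    ∃ ℓ z v : R, z ∈ maximalIdeal R ∧ v ∈ maximalIdeal R ∧
      b₀₁ * w₀ * w₁ + b₀₂ * w₀ * w₂ + b₀₃ * w₀ * w₃ + b₁₂ * w₁ * w₂ + b₁₃ * w₁ * w₃ + b₂₃ * w₂ * w₃
        - ℓ ^ 2 - z * v ∈ maximalIdeal R ^ 3 := by
  have h2 : (2 : R) = 0 := by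
    have := CharP.cast_eq_zero R 2
    simpa using this
  obtain ⟨i, hi⟩ := hu.exists_left_inv
  obtain ⟨ℓ, hℓ⟩ := exists_sq_sub_diag_mem hperf 0 0 (-(i * b₀₂ * b₁₂)) (-(i * b₀₃ * b₁₃)) 0 0 w₂ w₃
    (zero_mem _) (zero_mem _) h₂ h₃
  refine ⟨ℓ, i * (b₀₁ * w₁ + b₀₂ * w₂ + b₀₃ * w₃), b₀₁ * w₀ + b₁₂ * w₂ + b₁₃ * w₃, ?_, ?_, ?_⟩
  · exact Ideal.mul_mem_left _ _ (add_mem (add_mem (Ideal.mul_mem_left _ _ h₁)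
      (Ideal.mul_mem_left _ _ h₂)) (Ideal.mul_mem_left _ _ h₃))
  · exact add_mem (add_mem (Ideal.mul_mem_left _ _ h₀) (Ideal.mul_mem_left _ _ h₂))
      (Ideal.mul_mem_left _ _ h₃)
  · -- the Pfaffian term `i · Pf · w₂ w₃ ∈ 𝔪 ^ 3`
    have hpf3 : i * (b₀₁ * b₂₃ + b₀₂ * b₁₃ + b₀₃ * b₁₂) * w₂ * w₃ ∈ maximalIdeal R ^ 3 := by
      rw [mul_assoc i, mul_assoc i]
      exact Ideal.mul_mem_left _ _ (mul_mul_mem_pow_three hpf h₂ h₃)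
    have e : b₀₁ * w₀ * w₁ + b₀₂ * w₀ * w₂ + b₀₃ * w₀ * w₃ + b₁₂ * w₁ * w₂ + b₁₃ * w₁ * w₃ +
        b₂₃ * w₂ * w₃ - ℓ ^ 2 -
        i * (b₀₁ * w₁ + b₀₂ * w₂ + b₀₃ * w₃) * (b₀₁ * w₀ + b₁₂ * w₂ + b₁₃ * w₃) =
        (0 * (0 : R) ^ 2 + 0 * (0 : R) ^ 2 + -(i * b₀₂ * b₁₂) * w₂ ^ 2 + -(i * b₀₃ * b₁₃) * w₃ ^ 2
          - ℓ ^ 2) - i * (b₀₁ * b₂₃ + b₀₂ * b₁₃ + b₀₃ * b₁₂) * w₂ * w₃ := by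
      linear_combination (-(b₀₁ * w₀ * w₁ + b₀₂ * w₀ * w₂ + b₀₃ * w₀ * w₃ + b₁₂ * w₁ * w₂ +
        b₁₃ * w₁ * w₃ + b₂₃ * w₂ * w₃)) * hi + (i * b₀₁ * b₂₃ * w₂ * w₃) * h2
    rw [e]
    exact sub_mem hℓ hpf3

/-- **Polar rank `≤ 2` in four variables from the Pfaffian**: if the Pfaffian of the alternating matrix
`(b_{jk})` lies in `𝔪`, the off-diagonal expression in `w₀, …, w₃ ∈ 𝔪` is `ℓ ^ 2 + z v` modulo `𝔪 ^ 3`,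
`z, v ∈ 𝔪` (pivot on a unit entry — the Pfaffian is invariant under relabelling — or all entries lie in `𝔪`).
[folklore] -/
theorem offDiag_four (hperf : ∀ a : R, ∃ b : R, a - b ^ 2 ∈ maximalIdeal R)
    (b₀₁ b₀₂ b₀₃ b₁₂ b₁₃ b₂₃ w₀ w₁ w₂ w₃ : R)
    (hpf : b₀₁ * b₂₃ + b₀₂ * b₁₃ + b₀₃ * b₁₂ ∈ maximalIdeal R)
    (h₀ : w₀ ∈ maximalIdeal R) (h₁ : w₁ ∈ maximalIdeal R) (h₂ : w₂ ∈ maximalIdeal R)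
    (h₃ : w₃ ∈ maximalIdeal R) :
    ∃ ℓ z v : R, z ∈ maximalIdeal R ∧ v ∈ maximalIdeal R ∧
      b₀₁ * w₀ * w₁ + b₀₂ * w₀ * w₂ + b₀₃ * w₀ * w₃ + b₁₂ * w₁ * w₂ + b₁₃ * w₁ * w₃ + b₂₃ * w₂ * w₃
        - ℓ ^ 2 - z * v ∈ maximalIdeal R ^ 3 := by
  -- the target expression, as a function of a relabelling
  have main : ∀ (c₀₁ c₀₂ c₀₃ c₁₂ c₁₃ c₂₃ x₀ x₁ x₂ x₃ : R), IsUnit c₀₁ →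
      c₀₁ * c₂₃ + c₀₂ * c₁₃ + c₀₃ * c₁₂ ∈ maximalIdeal R →
      x₀ ∈ maximalIdeal R → x₁ ∈ maximalIdeal R → x₂ ∈ maximalIdeal R → x₃ ∈ maximalIdeal R →
      b₀₁ * w₀ * w₁ + b₀₂ * w₀ * w₂ + b₀₃ * w₀ * w₃ + b₁₂ * w₁ * w₂ + b₁₃ * w₁ * w₃ + b₂₃ * w₂ * w₃ =
        c₀₁ * x₀ * x₁ + c₀₂ * x₀ * x₂ + c₀₃ * x₀ * x₃ + c₁₂ * x₁ * x₂ + c₁₃ * x₁ * x₃ +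
          c₂₃ * x₂ * x₃ →
      ∃ ℓ z v : R, z ∈ maximalIdeal R ∧ v ∈ maximalIdeal R ∧
        b₀₁ * w₀ * w₁ + b₀₂ * w₀ * w₂ + b₀₃ * w₀ * w₃ + b₁₂ * w₁ * w₂ + b₁₃ * w₁ * w₃ +
          b₂₃ * w₂ * w₃ - ℓ ^ 2 - z * v ∈ maximalIdeal R ^ 3 := by
    intro c₀₁ c₀₂ c₀₃ c₁₂ c₁₃ c₂₃ x₀ x₁ x₂ x₃ hu hpf' k₀ k₁ k₂ k₃ e
    obtain ⟨ℓ, z, v, hz, hv, h⟩ :=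
      offDiag_four_of_isUnit hperf c₀₁ c₀₂ c₀₃ c₁₂ c₁₃ c₂₃ x₀ x₁ x₂ x₃ hu hpf' k₀ k₁ k₂ k₃
    exact ⟨ℓ, z, v, hz, hv, by rwa [e]⟩
  by_cases u₀₁ : IsUnit b₀₁
  · exact main b₀₁ b₀₂ b₀₃ b₁₂ b₁₃ b₂₃ w₀ w₁ w₂ w₃ u₀₁ hpf h₀ h₁ h₂ h₃ rfl
  by_cases u₀₂ : IsUnit b₀₂
  · exact main b₀₂ b₀₁ b₀₃ b₁₂ b₂₃ b₁₃ w₀ w₂ w₁ w₃ u₀₂ (by convert hpf using 1; ring) h₀ h₂ h₁ h₃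
      (by ring)
  by_cases u₀₃ : IsUnit b₀₃
  · exact main b₀₃ b₀₁ b₀₂ b₁₃ b₂₃ b₁₂ w₀ w₃ w₁ w₂ u₀₃ (by convert hpf using 1; ring) h₀ h₃ h₁ h₂
      (by ring)
  by_cases u₁₂ : IsUnit b₁₂
  · exact main b₁₂ b₀₁ b₁₃ b₀₂ b₂₃ b₀₃ w₁ w₂ w₀ w₃ u₁₂ (by convert hpf using 1; ring) h₁ h₂ h₀ h₃
      (by ring)
  by_cases u₁₃ : IsUnit b₁₃
  · exact main b₁₃ b₀₁ b₁₂ b₀₃ b₂₃ b₀₂ w₁ w₃ w₀ w₂ u₁₃ (by convert hpf using 1; ring) h₁ h₃ h₀ h₂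
      (by ring)
  by_cases u₂₃ : IsUnit b₂₃
  · exact main b₂₃ b₀₂ b₁₂ b₀₃ b₁₃ b₀₁ w₂ w₃ w₀ w₁ u₂₃ (by convert hpf using 1; ring) h₂ h₃ h₀ h₁
      (by ring)
  -- all six coefficients lie in `𝔪`
  rw [← mem_nonunits_iff, ← IsLocalRing.mem_maximalIdeal] at u₀₁ u₀₂ u₀₃ u₁₂ u₁₃ u₂₃
  refine ⟨0, 0, 0, zero_mem _, zero_mem _, ?_⟩
  have e : b₀₁ * w₀ * w₁ + b₀₂ * w₀ * w₂ + b₀₃ * w₀ * w₃ + b₁₂ * w₁ * w₂ + b₁₃ * w₁ * w₃ +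
      b₂₃ * w₂ * w₃ - 0 ^ 2 - 0 * 0 =
      b₀₁ * w₀ * w₁ + b₀₂ * w₀ * w₂ + b₀₃ * w₀ * w₃ + b₁₂ * w₁ * w₂ + b₁₃ * w₁ * w₃ +
        b₂₃ * w₂ * w₃ := by ring
  rw [e]
  refine add_mem (add_mem (add_mem (add_mem (add_mem ?_ ?_) ?_) ?_) ?_) ?_
  · exact mul_mul_mem_pow_three u₀₁ h₀ h₁
  · exact mul_mul_mem_pow_three u₀₂ h₀ h₂
  · exact mul_mul_mem_pow_three u₀₃ h₀ h₃
  · exact mul_mul_mem_pow_three u₁₂ h₁ h₂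
  · exact mul_mul_mem_pow_three u₁₃ h₁ h₃
  · exact mul_mul_mem_pow_three u₂₃ h₂ h₃

/-- **Polar rank `≤ 2` in four variables** (the algebraic core of B7 `rankFour_exit_two`): a quadratic
expression `Σ_{j,k<4} a_{jk} w_j w_k`, `w_j ∈ 𝔪`, whose polar matrix `b_{jk} = a_{jk} + a_{kj}` has
Pfaffian in `𝔪`, is `ℓ ^ 2 + z v` modulo `𝔪 ^ 3` with `z, v ∈ 𝔪`. [folklore] -/
theorem quadratic_four (hperf : ∀ a : R, ∃ b : R, a - b ^ 2 ∈ maximalIdeal R)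
    (a : Fin 4 → Fin 4 → R) (w : Fin 4 → R) (hw : ∀ j, w j ∈ maximalIdeal R)
    (hpf : (a 0 1 + a 1 0) * (a 2 3 + a 3 2) + (a 0 2 + a 2 0) * (a 1 3 + a 3 1) +
      (a 0 3 + a 3 0) * (a 1 2 + a 2 1) ∈ maximalIdeal R) :
    ∃ ℓ z v : R, z ∈ maximalIdeal R ∧ v ∈ maximalIdeal R ∧
      (∑ j, ∑ k, a j k * w j * w k) - ℓ ^ 2 - z * v ∈ maximalIdeal R ^ 3 := by
  obtain ⟨ℓ₁, z, v, hz, hv, hoff⟩ := offDiag_four hperf (a 0 1 + a 1 0) (a 0 2 + a 2 0)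
    (a 0 3 + a 3 0) (a 1 2 + a 2 1) (a 1 3 + a 3 1) (a 2 3 + a 3 2) (w 0) (w 1) (w 2) (w 3) hpf
    (hw 0) (hw 1) (hw 2) (hw 3)
  obtain ⟨ℓ₂, hdiag⟩ := exists_sq_sub_diag_mem hperf (a 0 0) (a 1 1) (a 2 2) (a 3 3) (w 0) (w 1)
    (w 2) (w 3) (hw 0) (hw 1) (hw 2) (hw 3)
  refine ⟨ℓ₁ + ℓ₂, z, v, hz, hv, ?_⟩
  have e : (∑ j, ∑ k, a j k * w j * w k) - (ℓ₁ + ℓ₂) ^ 2 - z * v =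
      ((a 0 1 + a 1 0) * w 0 * w 1 + (a 0 2 + a 2 0) * w 0 * w 2 + (a 0 3 + a 3 0) * w 0 * w 3 +
          (a 1 2 + a 2 1) * w 1 * w 2 + (a 1 3 + a 3 1) * w 1 * w 3 + (a 2 3 + a 3 2) * w 2 * w 3
          - ℓ₁ ^ 2 - z * v) +
        (a 0 0 * w 0 ^ 2 + a 1 1 * w 1 ^ 2 + a 2 2 * w 2 ^ 2 + a 3 3 * w 3 ^ 2 - ℓ₂ ^ 2) := by
    simp only [Fin.sum_univ_four, add_sq_char_two ℓ₁ ℓ₂]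
    ring
  rw [e]
  exact add_mem hoff hdiag

end Local

end Summit.ResolutionOfSingularities.ResolutionOfSingularities.Theorems.SwitchingDichotomy.PolarRank

end
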